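import Summits.Ventures.HodgeRepro.Tier3ProjectorCorrespondence

/-!
# The orbit projector commutes with the diagonal operators — §4(d)'s «`W_F(B) = e·K` is `R`-stable (`e` commutes
with `R`, `R` commutative)» on the kernel

Blind re-derivation cell `pub-hodge-repro`, seat `t3-p4` (Tier 3, T3.5 for T3.4 = Lemma R).  Target tree path
`lean/Summits/Ventures/HodgeRepro/Tier3ProjectorCommutes.lean`; imports the cell's `Tier3ProjectorCorrespondence`
(`diag_comp_diag`: `A′ b ∘ A′ b′ = A′ (b · b′)` for the diagonal operators `A′ b = (ω′ᵢ ↦ bᵢ • ω′ᵢ)`, and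
`exists_eq_sum_smul_map_diag`: the rational projector `e₀` onto the Weil line is a `ℚ`-combination
`Σ_m q_m • ⋀ⁿ(A′ b_m)` of the diagonal operators — LEMMA-R-RESIDUE.md §15).

WHAT THIS FILE STATES (LEMMA-R-RESIDUE.md §4(d): «`K` — and its `R`-stable subspace `W_F(B) = e·K` (`e` commutes with
`R`, `R` commutative) — is an `F`-vector space»).  The `R`-stability of the Weil line is on the kernel another way
(`Tier3WeilLineModule.weil_act_mem_of_generator`, from Lemma R's generator clause); this file states the paper's OWN
reason:

* `map_diag_comm` — the diagonal operators commute: `⋀ⁿ(A′ b) ∘ ⋀ⁿ(A′ b′) = ⋀ⁿ(A′ b′) ∘ ⋀ⁿ(A′ b)` («`R` commutative»: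
  `b · b′ = b′ · b` coordinatewise, `diag_comp_diag`, `exteriorPower.map_comp`);
* `comp_map_diag_eq_of_eq_sum_smul_map_diag` — **«`e` commutes with `R`»**: an operator `e₀ = Σ_m q_m • ⋀ⁿ(A′ b_m)` commutes
  with every `⋀ⁿ(A′ b)`;
* `comp_act_eq_of_eq_sum_smul_map_diag` — the case `b = (a at i₀, 1 elsewhere)`: `e₀` commutes with `act(a)`;
* `map_diag_mem_range_of_eq_sum_smul_map_diag` / `act_mem_range_of_eq_sum_smul_map_diag` — **«`W_F(B) = e·K` is
  `R`-stable»**: the range of such an `e₀` is stable under every `⋀ⁿ(A′ b)`, in particular under `act(a)`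
  (`⋀ⁿ(A′ b) (e₀ v) = e₀ (⋀ⁿ(A′ b) v)`);
* `act_mem_of_eq_sum_smul_map_diag_of_range` — the same for any `W_F` with `e₀ v ∈ W_F` for all `v` and `e₀ = id` on
  `W_F` (the clauses of `Tier3WeilProjector.exists_rational_projector`): `W_F` is `act`-stable.

HONESTY.  A LABEL for one parenthetical of §4(d); the `act`-stability of `W_F` that Lemma R uses is already on the kernel
by the generator route (§21), and the two-line content here (`diag_comp_diag` + `mul_comm`) is stated so that the paper's
sentence has a twin by name.  Linear algebra on the cell's own modules and Mathlib; no definition, instance or notation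
is introduced; nothing geometric is built.  Nothing mathematical moves (LEMMA-R-RESIDUE: residue 0 unchanged).  HC_CM is
NOT proved by anyone in this repository.
-/

set_option autoImplicit false

open TensorProduct Finset

namespace HodgeRepro.Tier3

section Commutes

variable {F₀ K : Type*} [Field F₀] [Field K] [Algebra F₀ K]
variable {VB : Type*} [AddCommGroup VB] [Module K VB] [Module F₀ VB] [IsScalarTower F₀ K VB]
variable {ι : Type*}

/-- **The diagonal operators commute** («`R` commutative»): `⋀ⁿ(A′ b) ∘ ⋀ⁿ(A′ b′) = ⋀ⁿ(A′ b′) ∘ ⋀ⁿ(A′ b)` — both are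
`⋀ⁿ(A′ (b · b′))` (`diag_comp_diag`, `exteriorPower.map_comp`, `mul_comm`). -/
theorem map_diag_comm (ω' : Module.Basis ι K VB) (n : ℕ) (b b' : ι → K) :
    exteriorPower.map n ((ω'.constr K fun i => b i • ω' i).restrictScalars F₀) ∘ₗ
        exteriorPower.map n ((ω'.constr K fun i => b' i • ω' i).restrictScalars F₀) =
      exteriorPower.map n ((ω'.constr K fun i => b' i • ω' i).restrictScalars F₀) ∘ₗ
        exteriorPower.map n ((ω'.constr K fun i => b i • ω' i).restrictScalars F₀) := by
  rw [← exteriorPower.map_comp, ← exteriorPower.map_comp, diag_comp_diag, diag_comp_diag, mul_comm]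

/-- **«`e` commutes with `R`»**: an operator `e₀ = Σ_m q_m • ⋀ⁿ(A′ b_m)` (the rational projector of §15,
`exists_eq_sum_smul_map_diag`) commutes with every diagonal operator `⋀ⁿ(A′ b)`. -/
theorem comp_map_diag_eq_of_eq_sum_smul_map_diag (ω' : Module.Basis ι K VB) (n : ℕ)
    (e₀ : ⋀[F₀]^n VB →ₗ[F₀] ⋀[F₀]^n VB) {N : ℕ} (q : Fin N → F₀) (b : Fin N → (ι → K))
    (he₀ : e₀ = ∑ m, q m • exteriorPower.map n ((ω'.constr K fun i => b m i • ω' i).restrictScalars F₀))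
    (b' : ι → K) :
    e₀ ∘ₗ exteriorPower.map n ((ω'.constr K fun i => b' i • ω' i).restrictScalars F₀) =
      exteriorPower.map n ((ω'.constr K fun i => b' i • ω' i).restrictScalars F₀) ∘ₗ e₀ := by
  rw [he₀]
  apply LinearMap.ext
  intro v
  simp only [LinearMap.comp_apply, LinearMap.sum_apply, map_sum, LinearMap.smul_apply, map_smul]
  refine Finset.sum_congr rfl fun m _ => ?_
  exact congrArg (q m • ·) (LinearMap.congr_fun (map_diag_comm ω' n (b m) b') v)

/-- `e₀` commutes with `act(a) = ⋀ⁿ(A′ (a at i₀, 1 elsewhere))`. -/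
theorem comp_act_eq_of_eq_sum_smul_map_diag [DecidableEq ι] (ω' : Module.Basis ι K VB) (n : ℕ)
    (e₀ : ⋀[F₀]^n VB →ₗ[F₀] ⋀[F₀]^n VB) {N : ℕ} (q : Fin N → F₀) (b : Fin N → (ι → K))
    (he₀ : e₀ = ∑ m, q m • exteriorPower.map n ((ω'.constr K fun i => b m i • ω' i).restrictScalars F₀))
    (i₀ : ι) (a : K) :
    e₀ ∘ₗ exteriorPower.map n
        ((ω'.constr K fun i => Function.update (fun _ => (1 : K)) i₀ a i • ω' i).restrictScalars F₀) =
      exteriorPower.map n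
        ((ω'.constr K fun i => Function.update (fun _ => (1 : K)) i₀ a i • ω' i).restrictScalars F₀) ∘ₗ e₀ :=
  comp_map_diag_eq_of_eq_sum_smul_map_diag ω' n e₀ q b he₀ _

/-- **«`W_F(B) = e·K` is `R`-stable»**: the range of `e₀ = Σ_m q_m • ⋀ⁿ(A′ b_m)` is stable under every diagonal
operator — `⋀ⁿ(A′ b) (e₀ v) = e₀ (⋀ⁿ(A′ b) v)`. -/
theorem map_diag_mem_range_of_eq_sum_smul_map_diag (ω' : Module.Basis ι K VB) (n : ℕ)
    (e₀ : ⋀[F₀]^n VB →ₗ[F₀] ⋀[F₀]^n VB) {N : ℕ} (q : Fin N → F₀) (b : Fin N → (ι → K))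
    (he₀ : e₀ = ∑ m, q m • exteriorPower.map n ((ω'.constr K fun i => b m i • ω' i).restrictScalars F₀))
    (b' : ι → K) (w : ⋀[F₀]^n VB) (hw : w ∈ LinearMap.range e₀) :
    exteriorPower.map n ((ω'.constr K fun i => b' i • ω' i).restrictScalars F₀) w ∈ LinearMap.range e₀ := by
  obtain ⟨v, rfl⟩ := hw
  refine ⟨exteriorPower.map n ((ω'.constr K fun i => b' i • ω' i).restrictScalars F₀) v, ?_⟩
  rw [← LinearMap.comp_apply, comp_map_diag_eq_of_eq_sum_smul_map_diag ω' n e₀ q b he₀ b', LinearMap.comp_apply]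

/-- The range of `e₀` is `act`-stable. -/
theorem act_mem_range_of_eq_sum_smul_map_diag [DecidableEq ι] (ω' : Module.Basis ι K VB) (n : ℕ)
    (e₀ : ⋀[F₀]^n VB →ₗ[F₀] ⋀[F₀]^n VB) {N : ℕ} (q : Fin N → F₀) (b : Fin N → (ι → K))
    (he₀ : e₀ = ∑ m, q m • exteriorPower.map n ((ω'.constr K fun i => b m i • ω' i).restrictScalars F₀))
    (i₀ : ι) (a : K) (w : ⋀[F₀]^n VB) (hw : w ∈ LinearMap.range e₀) :
    exteriorPower.map n
        ((ω'.constr K fun i => Function.update (fun _ => (1 : K)) i₀ a i • ω' i).restrictScalars F₀) w ∈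
      LinearMap.range e₀ :=
  map_diag_mem_range_of_eq_sum_smul_map_diag ω' n e₀ q b he₀ _ w hw

/-- **§4(d)'s sentence on the projector's data**: for a subspace `W_F` with `e₀ v ∈ W_F` for every `v` and `e₀ = id`
on `W_F` (the clauses of `Tier3WeilProjector.exists_rational_projector`), `W_F` is stable under every `⋀ⁿ(A′ b)`, in
particular under `act(a)` — `W_F` is the range of `e₀`, which commutes with `R`. -/
theorem map_diag_mem_of_eq_sum_smul_map_diag_of_range (ω' : Module.Basis ι K VB) (n : ℕ)
    (e₀ : ⋀[F₀]^n VB →ₗ[F₀] ⋀[F₀]^n VB) {N : ℕ} (q : Fin N → F₀) (b : Fin N → (ι → K))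
    (he₀ : e₀ = ∑ m, q m • exteriorPower.map n ((ω'.constr K fun i => b m i • ω' i).restrictScalars F₀))
    (WF : Submodule F₀ (⋀[F₀]^n VB)) (hWF : ∀ v, e₀ v ∈ WF) (hid : ∀ w ∈ WF, e₀ w = w)
    (b' : ι → K) (w : ⋀[F₀]^n VB) (hw : w ∈ WF) :
    exteriorPower.map n ((ω'.constr K fun i => b' i • ω' i).restrictScalars F₀) w ∈ WF := by
  have hrange : w ∈ LinearMap.range e₀ := ⟨w, hid w hw⟩
  obtain ⟨v, hv⟩ := map_diag_mem_range_of_eq_sum_smul_map_diag ω' n e₀ q b he₀ b' w hrange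
  rw [← hv]
  exact hWF v

/-- `W_F` is `act`-stable, from the projector's data alone. -/
theorem act_mem_of_eq_sum_smul_map_diag_of_range [DecidableEq ι] (ω' : Module.Basis ι K VB) (n : ℕ)
    (e₀ : ⋀[F₀]^n VB →ₗ[F₀] ⋀[F₀]^n VB) {N : ℕ} (q : Fin N → F₀) (b : Fin N → (ι → K))
    (he₀ : e₀ = ∑ m, q m • exteriorPower.map n ((ω'.constr K fun i => b m i • ω' i).restrictScalars F₀))
    (WF : Submodule F₀ (⋀[F₀]^n VB)) (hWF : ∀ v, e₀ v ∈ WF) (hid : ∀ w ∈ WF, e₀ w = w)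
    (i₀ : ι) (a : K) (w : ⋀[F₀]^n VB) (hw : w ∈ WF) :
    exteriorPower.map n
        ((ω'.constr K fun i => Function.update (fun _ => (1 : K)) i₀ a i • ω' i).restrictScalars F₀) w ∈ WF :=
  map_diag_mem_of_eq_sum_smul_map_diag_of_range ω' n e₀ q b he₀ WF hWF hid _ w hw

end Commutes

end HodgeRepro.Tier3
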